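import Summits.KontsevichZagierPeriods.Zeta5Search.Barrier.ConeGammaLogCuspThin

/-!
# ζ(5) search — BARRIER: one period of the perturbed orbit = the rigid translate with frozen weight, up to `O(ε)`

HONEST FRAMING (cell `pub-zeta5`): systematic search; no irrationality claim unless kernel-certified. MODEL objects
under Brown–Zudilin's (28)+(30) accounting ([BZ22] = arXiv:2210.03391); nothing here is a statement about `ζ(5)`,
about `γ`, or about the cone's supremum (C2 = `BarrierC2` stays OPEN; the lemma S-E stays CONJECTURED); records in
print UNMOVED. Prover P2 g19 (self-selected Lean-only item of the P2 lineage; sources: P2 g11 `SE-STRUCTURE.md` §3,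
lead/lit g27 `SE-DESK-NOTE.md` §2; builds on the theory seat's (P4) chain `ConeGammaShift*` of cert-2 g17).

Part 2/3 of the kernel LOG-CUSP SHAPE theorem (`ConeGammaLogCusp`): the desk-note decomposition, period by period.
With `Δ_ε(u) := 𝒩(u·s(a) + (uε)·δ) − 𝒩(u·s(a))` (the integrand of `Φ(s(a) + εδ) − Φ(s(a))` in torus form),
`P(·) = translateIntegral a T ·`, `Y = shiftSize δ`, `C₁ := 392·Y·(T·x_max + 5)/x_min`:

* `abs_integral_add_mul_sub_le` — calculus: freezing a continuous weight `w` at `w₀` on `[0, T]` costs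
  `w₀·∫|A| + sup|w − w₀|·∫|B|`;
* **`abs_period_integral_sub_translate_le`** — for `k ≥ 1` (periodicity `u = kT + s`):
  `|∫_{kT}^{(k+1)T} Δ_ε u⁻² − (P(εkT·δ) − P(0))/(kT)²| ≤ εT·C₁/(kT)² + εkT·C₁·((kT)⁻² − ((k+1)T)⁻²)`
  (drift `(sε)·δ` and weight freezing, both by part 1's first-moment bound), for `εT·Y ≤ 1`, `εkT·Y ≤ 1`;
* **`abs_head_integral_le`** — `|∫₀ᵀ Δ_ε u⁻²| ≤ (2x_max)²·εT·C₁` (nothing changes on `(0, 1/(2x_max)]`,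
  `torusN_drift_eq_of_small`); **`abs_tail_integral_le`** — `|∫_{(U,∞)} Δ_ε u⁻²| ≤ 7/U`;
* **`exists_admissible_scale`** — some `ρ > 0` meets the three hypotheses of Lemma B
  (`translateIntegral_shift_linear`: `ρK < 1`, `ρK < d`, `2ρW ≤` every breakpoint gap), so the one-sided slope
  `σ = (P(ρδ) − P(0))/ρ` exists; `translateIntegral_sub_eq_mul_slope` — it does not depend on the admissible `ρ`.
-/


noncomputable section

open Set MeasureTheory
open scoped Topology

namespace Summit.KontsevichZagierPeriods.Zeta5Search.Barrier.ConeGamma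

/-! ### Calculus: freezing a weight on one period -/

/-- **Weight freezing.** For integrable `A`, `B` on `[0, T]` and a continuous weight `w` with `|w| ≤ w₀` and
`|w − w₀| ≤ d` on `(0, T]`: `|∫₀ᵀ (A + B)·w − w₀·∫₀ᵀ B| ≤ w₀·∫|A| + d·∫|B|`. -/
theorem abs_integral_add_mul_sub_le {A B w : ℝ → ℝ} {T w₀ d CA CB : ℝ} (hT : 0 ≤ T)
    (hA : IntervalIntegrable A volume 0 T) (hB : IntervalIntegrable B volume 0 T)
    (hw : ContinuousOn w (uIcc 0 T)) (hw₀ : 0 ≤ w₀) (hd : 0 ≤ d)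
    (hw1 : ∀ s ∈ Ioc 0 T, |w s| ≤ w₀) (hw2 : ∀ s ∈ Ioc 0 T, |w s - w₀| ≤ d)
    (hAi : ∫ s in Ioc 0 T, |A s| ≤ CA) (hBi : ∫ s in Ioc 0 T, |B s| ≤ CB) :
    |(∫ s in (0 : ℝ)..T, (A s + B s) * w s) - w₀ * ∫ s in (0 : ℝ)..T, B s| ≤ w₀ * CA + d * CB := by
  have hAw : IntervalIntegrable (fun s => A s * w s) volume 0 T := hA.mul_continuousOn hw
  have hBw : IntervalIntegrable (fun s => B s * (w s - w₀)) volume 0 T :=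
    hB.mul_continuousOn (hw.sub continuousOn_const)
  have hsplit : (∫ s in (0 : ℝ)..T, (A s + B s) * w s) - w₀ * ∫ s in (0 : ℝ)..T, B s
      = (∫ s in (0 : ℝ)..T, A s * w s) + ∫ s in (0 : ℝ)..T, B s * (w s - w₀) := by
    have h1 : ∫ s in (0 : ℝ)..T, (A s + B s) * w s
        = (∫ s in (0 : ℝ)..T, A s * w s) + ∫ s in (0 : ℝ)..T, B s * w s := by
      rw [← intervalIntegral.integral_add hAw (hB.mul_continuousOn hw)]
      refine intervalIntegral.integral_congr fun s _ => ?_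
      ring
    have h2 : ∫ s in (0 : ℝ)..T, B s * (w s - w₀)
        = (∫ s in (0 : ℝ)..T, B s * w s) - w₀ * ∫ s in (0 : ℝ)..T, B s := by
      rw [← intervalIntegral.integral_const_mul, ← intervalIntegral.integral_sub (hB.mul_continuousOn hw)
        (hB.const_mul w₀)]
      refine intervalIntegral.integral_congr fun s _ => ?_
      ring
    rw [h1, h2]; ring
  rw [hsplit]
  have hA1 : |∫ s in (0 : ℝ)..T, A s * w s| ≤ w₀ * CA := by
    have h := intervalIntegral.norm_integral_le_of_norm_le (f := fun s => A s * w s)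
      (g := fun s => |A s| * w₀) hT (Filter.Eventually.of_forall fun s hs => ?_) (hA.abs.mul_const w₀)
    · rw [Real.norm_eq_abs] at h
      refine h.trans ?_
      rw [intervalIntegral.integral_mul_const, intervalIntegral.integral_of_le hT, mul_comm]
      exact mul_le_mul_of_nonneg_left hAi hw₀
    · rw [Real.norm_eq_abs, abs_mul]
      exact mul_le_mul_of_nonneg_left (hw1 s hs) (abs_nonneg _)
  have hB1 : |∫ s in (0 : ℝ)..T, B s * (w s - w₀)| ≤ d * CB := by
    have h := intervalIntegral.norm_integral_le_of_norm_le (f := fun s => B s * (w s - w₀))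
      (g := fun s => |B s| * d) hT (Filter.Eventually.of_forall fun s hs => ?_) (hB.abs.mul_const d)
    · rw [Real.norm_eq_abs] at h
      refine h.trans ?_
      rw [intervalIntegral.integral_mul_const, intervalIntegral.integral_of_le hT, mul_comm]
      exact mul_le_mul_of_nonneg_left hBi hd
    · rw [Real.norm_eq_abs, abs_mul]
      exact mul_le_mul_of_nonneg_left (hw2 s hs) (abs_nonneg _)
  exact (abs_add_le _ _).trans (add_le_add hA1 hB1)


/-! ### One period `[kT, (k+1)T]`, `k ≥ 1`: the rigid translate with frozen weight, up to two small errors -/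

/-- The perturbed orbit is a line: `s·s(a) + c + (s·ε)·δ = s·s(a′) + c` with `s(a′) = s(a) + ε·δ`. -/
theorem driftLine_eq (a : Dir) (δ c : Fin 8 → ℝ) (ε s : ℝ) :
    s • sParam a + c + (s * ε) • δ = s • sParam (aOfS (sParam a + ε • δ)) + c := by
  rw [sParam_aOfS, smul_add, smul_smul]; abel

/-- `s ↦ 𝒩(s·s(a) + c + (s·ε)·δ)` is interval integrable. -/
theorem intervalIntegrable_torusN_driftLine (a : Dir) (δ c : Fin 8 → ℝ) (ε α β : ℝ) :
    IntervalIntegrable (fun s : ℝ => (torusN (s • sParam a + c + (s * ε) • δ) : ℝ)) volume α β := by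
  have h := intervalIntegrable_torusN_line (aOfS (sParam a + ε • δ)) c α β
  have hfun : (fun s : ℝ => (torusN (s • sParam a + c + (s * ε) • δ) : ℝ))
      = fun s : ℝ => (torusN (s • sParam (aOfS (sParam a + ε • δ)) + c) : ℝ) := by
    funext s; rw [driftLine_eq]
  rw [hfun]; exact h

/-- Periodicity along the orbit: `𝒩((s + kT)·s(a) + v) = 𝒩(s·s(a) + v)` for a period `T`. -/
theorem torusN_line_add_nat_mul_period {a : Dir} {T : ℝ} (hper : ∀ k : Fin 28, ∃ z : ℤ, T * h28 a k = z)
    (v : Fin 8 → ℝ) (s : ℝ) (k : ℕ) : torusN ((s + k * T) • sParam a + v) = torusN (s • sParam a + v) := by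
  have h := (periodic_torusN_line hper v).nat_mul k s
  exact_mod_cast h

/-- **Period `k ≥ 1`.** With `Δ_ε(u) = 𝒩(u·s(a) + (uε)·δ) − 𝒩(u·s(a))`, `δ_k = (ε k T)·δ` and
`C₁ = 392·Y·(T·x_max + 5)/x_min`:
`|∫_{kT}^{(k+1)T} Δ_ε(u) u⁻² du − (P(δ_k) − P(0))/(kT)²| ≤ εT·C₁/(kT)² + εkT·C₁·((kT)⁻² − ((k+1)T)⁻²)`
(periodicity `u = kT + s`; the drift `(sε)·δ` and the weight freezing are first-moment small by
`setIntegral_abs_torusN_sub_le_linear`), provided `εT·Y ≤ 1` and `εkT·Y ≤ 1`. -/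
theorem abs_period_integral_sub_translate_le {a : Dir} (hpos : ∀ k, 0 < h28 a k) {T : ℝ} (hT : 0 < T)
    (hper : ∀ k : Fin 28, ∃ z : ℤ, T * h28 a k = z) (δ : Fin 8 → ℝ) {ε : ℝ} (hε : 0 ≤ ε)
    (hεY : ε * T * shiftSize δ ≤ 1) {k : ℕ} (hk : 1 ≤ k) (hkY : ε * (k * T) * shiftSize δ ≤ 1) :
    |(∫ u in ((k : ℝ) * T)..(((k : ℝ) + 1) * T),
        ((torusN (u • sParam a + (u * ε) • δ) : ℝ) - torusN (u • sParam a)) / u ^ 2)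
      - (translateIntegral a T ((ε * (k * T)) • δ) - translateIntegral a T 0) / ((k : ℝ) * T) ^ 2|
      ≤ (1 / ((k : ℝ) * T) ^ 2) * ((ε * T) * (392 * shiftSize δ * (T * xMax a + 5) / xMin a))
        + (1 / ((k : ℝ) * T) ^ 2 - 1 / (((k : ℝ) + 1) * T) ^ 2)
          * ((ε * (k * T)) * (392 * shiftSize δ * (T * xMax a + 5) / xMin a)) := by
  have hk1 : (1 : ℝ) ≤ k := by exact_mod_cast hk
  have hk0 : (0 : ℝ) < k * T := mul_pos (by linarith) hT
  set c : Fin 8 → ℝ := (ε * (k * T)) • δ with hc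
  -- the three players on `[0, T]`
  set A : ℝ → ℝ := fun s => (torusN (s • sParam a + c + (s * ε) • δ) : ℝ) - torusN (s • sParam a + c)
    with hA
  set B : ℝ → ℝ := fun s => (torusN (s • sParam a + c) : ℝ) - torusN (s • sParam a) with hB
  set w : ℝ → ℝ := fun s => 1 / (s + k * T) ^ 2 with hw
  -- Step 1: substitution `u = s + kT` and periodicity
  have hsub : (∫ u in ((k : ℝ) * T)..(((k : ℝ) + 1) * T),
        ((torusN (u • sParam a + (u * ε) • δ) : ℝ) - torusN (u • sParam a)) / u ^ 2)
      = ∫ s in (0 : ℝ)..T, (A s + B s) * w s := by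
    have h := intervalIntegral.integral_comp_add_right (a := 0) (b := T)
      (fun u : ℝ => ((torusN (u • sParam a + (u * ε) • δ) : ℝ) - torusN (u • sParam a)) / u ^ 2)
      ((k : ℝ) * T)
    rw [zero_add, show T + (k : ℝ) * T = ((k : ℝ) + 1) * T by ring] at h
    rw [← h]
    refine intervalIntegral.integral_congr fun s _ => ?_
    have h1 : torusN ((s + k * T) • sParam a + ((s + k * T) * ε) • δ)
        = torusN (s • sParam a + c + (s * ε) • δ) := by
      rw [torusN_line_add_nat_mul_period hper, hc, show (s + k * T) * ε = ε * (k * T) + s * ε by ring,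
        add_smul, add_assoc]
    have h2 : torusN ((s + k * T) • sParam a) = torusN (s • sParam a) := by
      have := torusN_line_add_nat_mul_period hper 0 s k
      simpa using this
    simp only [hA, hB, hw, h1, h2]
    ring
  -- Step 2: the data of the weight-freezing lemma
  have hAint : IntervalIntegrable A volume 0 T :=
    (intervalIntegrable_torusN_driftLine a δ c ε 0 T).sub (intervalIntegrable_torusN_line a c 0 T)
  have hBint : IntervalIntegrable B volume 0 T := intervalIntegrable_shiftDiff a δ (ε * (k * T)) 0 T
  have hwcont : ContinuousOn w (uIcc 0 T) := by
    refine continuousOn_const.div (by fun_prop) fun s hs => ?_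
    rw [uIcc_of_le hT.le] at hs
    have : 0 < s + k * T := by linarith [hs.1]
    positivity
  have hw1 : ∀ s ∈ Ioc 0 T, |w s| ≤ 1 / ((k : ℝ) * T) ^ 2 := by
    intro s hs
    have hspos : 0 < s + k * T := by linarith [hs.1]
    rw [hw, abs_of_pos (by positivity)]
    exact one_div_le_one_div_of_le (by positivity) (by nlinarith [hs.1])
  have hw2 : ∀ s ∈ Ioc 0 T, |w s - 1 / ((k : ℝ) * T) ^ 2|
      ≤ 1 / ((k : ℝ) * T) ^ 2 - 1 / (((k : ℝ) + 1) * T) ^ 2 := by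
    intro s hs
    have hspos : 0 < s + k * T := by linarith [hs.1]
    have hle1 : w s ≤ 1 / ((k : ℝ) * T) ^ 2 :=
      one_div_le_one_div_of_le (by positivity) (by nlinarith [hs.1])
    have hle2 : 1 / (((k : ℝ) + 1) * T) ^ 2 ≤ w s :=
      one_div_le_one_div_of_le (by positivity) (by nlinarith [hs.2, hT])
    rw [abs_sub_comm, abs_of_nonneg (by linarith)]
    linarith
  have hw₀ : (0 : ℝ) ≤ 1 / ((k : ℝ) * T) ^ 2 := by positivity
  have hd : (0 : ℝ) ≤ 1 / ((k : ℝ) * T) ^ 2 - 1 / (((k : ℝ) + 1) * T) ^ 2 := by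
    have : 1 / (((k : ℝ) + 1) * T) ^ 2 ≤ 1 / ((k : ℝ) * T) ^ 2 :=
      one_div_le_one_div_of_le (by positivity) (by nlinarith [hT])
    linarith
  -- Step 3: the two first-moment bounds
  have hAi : ∫ s in Ioc 0 T, |A s| ≤ (ε * T) * (392 * shiftSize δ * (T * xMax a + 5) / xMin a) := by
    refine setIntegral_abs_torusN_sub_le_linear hpos c (fun s => (s * ε) • δ) δ hT.le (by positivity) hεY
      fun s hs k' => ?_
    rw [phiForm_smul, abs_mul, abs_of_nonneg (mul_nonneg hs.1.le hε)]
    exact mul_le_mul_of_nonneg_right (by nlinarith [hs.2]) (abs_nonneg _)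
  have hBi : ∫ s in Ioc 0 T, |B s| ≤ (ε * (k * T)) * (392 * shiftSize δ * (T * xMax a + 5) / xMin a) := by
    have h := setIntegral_abs_torusN_sub_le_linear hpos 0 (fun _ => c) δ hT.le (t := ε * (k * T))
      (by positivity) hkY fun s _ k' => ?_
    · simpa only [add_zero] using h
    · rw [hc, phiForm_smul, abs_mul, abs_of_nonneg (by positivity)]
  -- Step 4: assemble
  have hPB : ∫ s in (0 : ℝ)..T, B s = translateIntegral a T ((ε * (k * T)) • δ) - translateIntegral a T 0 :=
    (translateIntegral_sub_eq a T δ (ε * (k * T))).symm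
  have key := abs_integral_add_mul_sub_le hT.le hAint hBint hwcont hw₀ hd hw1 hw2 hAi hBi
  rw [hPB] at key
  rw [hsub, div_eq_mul_one_div (translateIntegral a T _ - _), mul_comm (translateIntegral a T _ - _)]
  exact key


/-! ### The head period `(0, T]` and the tail `(U, ∞)` -/

/-- Near `u = 0` nothing changes: for `0 < u ≤ 1/(2 x_max)` and `εY ≤ x_min/2`,
`𝒩(u·s(a) + (uε)·δ) = 𝒩(u·s(a))` (all forms stay in `(0, 1)` and move by less than their distance to `ℤ`). -/
theorem torusN_drift_eq_of_small {a : Dir} (hpos : ∀ k, 0 < h28 a k) (δ : Fin 8 → ℝ) {ε u : ℝ} (hε : 0 ≤ ε)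
    (hεY : ε * shiftSize δ ≤ xMin a / 2) (hu0 : 0 < u) (hu : u ≤ 1 / (2 * xMax a)) :
    torusN (u • sParam a + (u * ε) • δ) = torusN (u • sParam a) := by
  refine torusN_add_eq_of_forms_far fun k z => ?_
  rw [phiForm_smul, phiForm_smul_sParam]
  have hx := hpos k
  have hxM := xMax_pos hpos
  have hux : 0 < u * h28 a k := mul_pos hu0 hx
  have huxle : u * h28 a k ≤ 1 / 2 := by
    calc u * h28 a k ≤ (1 / (2 * xMax a)) * xMax a := mul_le_mul hu (le_xMax a k) hx.le (by positivity)
      _ = 1 / 2 := by field_simp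
  have hsmall : |u * ε * phiForm δ k| ≤ u * h28 a k / 2 := by
    rw [abs_mul, abs_of_nonneg (mul_nonneg hu0.le hε), mul_assoc]
    have h1 : ε * |phiForm δ k| ≤ h28 a k / 2 :=
      (mul_le_mul_of_nonneg_left (abs_phiForm_le_shiftSize δ k) hε).trans (hεY.trans (by linarith [xMin_le a k]))
    have := mul_le_mul_of_nonneg_left h1 hu0.le
    linarith
  rcases lt_trichotomy z 0 with hz | rfl | hz
  · have hz' : (z : ℝ) ≤ -1 := by exact_mod_cast (show z ≤ -1 by omega)
    rw [abs_of_pos (show (0 : ℝ) < u * h28 a k - z by linarith)]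
    linarith
  · simp only [Int.cast_zero, sub_zero, abs_of_pos hux]
    linarith
  · have hz' : (1 : ℝ) ≤ z := by exact_mod_cast (show 1 ≤ z by omega)
    rw [abs_of_nonpos (show u * h28 a k - z ≤ 0 by linarith)]
    linarith

/-- **The head period.** `|∫₀ᵀ Δ_ε(u) u⁻² du| ≤ (2 x_max)²·(εT·C₁)`: the integrand vanishes on `(0, 1/(2x_max)]`
(`torusN_drift_eq_of_small`), and beyond it the weight is at most `(2x_max)²` while the drift has first moment
`≤ εT·C₁` on `(0, T]`. -/
theorem abs_head_integral_le {a : Dir} (hpos : ∀ k, 0 < h28 a k) {T : ℝ} (hT : 0 < T) (δ : Fin 8 → ℝ) {ε : ℝ}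
    (hε : 0 ≤ ε) (hεY : ε * T * shiftSize δ ≤ 1) (hεY2 : ε * shiftSize δ ≤ xMin a / 2) :
    |∫ u in (0 : ℝ)..T, ((torusN (u • sParam a + (u * ε) • δ) : ℝ) - torusN (u • sParam a)) / u ^ 2|
      ≤ (2 * xMax a) ^ 2 * ((ε * T) * (392 * shiftSize δ * (T * xMax a + 5) / xMin a)) := by
  have hxM := xMax_pos hpos
  set Δ : ℝ → ℝ := fun u => (torusN (u • sParam a + (u * ε) • δ) : ℝ) - torusN (u • sParam a) with hΔ
  have hΔint : IntervalIntegrable Δ volume 0 T := by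
    have h1 := intervalIntegrable_torusN_driftLine a δ 0 ε 0 T
    have h2 := intervalIntegrable_torusN_line a 0 0 T
    simp only [add_zero] at h1 h2
    exact h1.sub h2
  have hdom : ∀ u ∈ Ioc 0 T, ‖Δ u / u ^ 2‖ ≤ (2 * xMax a) ^ 2 * |Δ u| := by
    intro u hu
    rw [Real.norm_eq_abs]
    rcases le_or_gt u (1 / (2 * xMax a)) with hsmall | hbig
    · have : Δ u = 0 := by
        simp only [hΔ, sub_eq_zero, Int.cast_inj]
        exact torusN_drift_eq_of_small hpos δ hε hεY2 hu.1 hsmall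
      simp [this]
    · rw [abs_div, abs_of_pos (pow_pos hu.1 2), div_eq_mul_inv, mul_comm]
      refine mul_le_mul_of_nonneg_right ?_ (abs_nonneg _)
      rw [inv_le_comm₀ (pow_pos hu.1 2) (by positivity)]
      calc ((2 * xMax a) ^ 2)⁻¹ = (1 / (2 * xMax a)) ^ 2 := by rw [one_div, inv_pow]
        _ ≤ u ^ 2 := pow_le_pow_left₀ (by positivity) hbig.le 2
  have h := intervalIntegral.norm_integral_le_of_norm_le (f := fun u => Δ u / u ^ 2) hT.le
    (Filter.Eventually.of_forall hdom) (hΔint.abs.const_mul _)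
  rw [Real.norm_eq_abs] at h
  refine h.trans ?_
  rw [intervalIntegral.integral_const_mul, intervalIntegral.integral_of_le hT.le]
  refine mul_le_mul_of_nonneg_left ?_ (by positivity)
  have h' := setIntegral_abs_torusN_sub_le_linear hpos 0 (fun s => (s * ε) • δ) δ hT.le (t := ε * T)
    (by positivity) hεY fun s hs k' => ?_
  · simpa only [add_zero] using h'
  · rw [phiForm_smul, abs_mul, abs_of_nonneg (mul_nonneg hs.1.le hε)]
    exact mul_le_mul_of_nonneg_right (by nlinarith [hs.2]) (abs_nonneg _)

/-- **The tail.** `|∫_{(U,∞)} Δ_ε(u) u⁻² du| ≤ 7/U` (`0 ≤ 𝒩 ≤ 7`). -/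
theorem abs_tail_integral_le (a : Dir) (δ : Fin 8 → ℝ) (ε : ℝ) {U : ℝ} (hU : 0 < U) :
    |∫ u in Ioi U, ((torusN (u • sParam a + (u * ε) • δ) : ℝ) - torusN (u • sParam a)) / u ^ 2| ≤ 7 / U := by
  have hg : IntegrableOn (fun u : ℝ => 7 * u ^ (-2 : ℝ)) (Ioi U) :=
    (integrableOn_Ioi_rpow_of_lt (by norm_num) hU).const_mul 7
  have hval : ∫ u in Ioi U, 7 * u ^ (-2 : ℝ) = 7 / U := by
    rw [integral_const_mul, integral_Ioi_rpow_of_lt (by norm_num) hU]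
    rw [show (-2 : ℝ) + 1 = -1 by norm_num, Real.rpow_neg_one]
    field_simp
  have hdom : ∀ᵐ u ∂(volume.restrict (Ioi U)),
      ‖((torusN (u • sParam a + (u * ε) • δ) : ℝ) - torusN (u • sParam a)) / u ^ 2‖ ≤ 7 * u ^ (-2 : ℝ) := by
    refine (ae_restrict_iff' measurableSet_Ioi).mpr (Filter.Eventually.of_forall fun u (hu : u ∈ Ioi U) => ?_)
    have hu0 : 0 < u := hU.trans hu
    rw [Real.norm_eq_abs, abs_div, abs_of_pos (pow_pos hu0 2),
      show u ^ (-2 : ℝ) = (u ^ 2)⁻¹ by rw [Real.rpow_neg hu0.le, Real.rpow_two], div_eq_mul_inv]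
    refine mul_le_mul_of_nonneg_right ?_ (by positivity)
    rw [abs_sub_le_iff]
    have h1 : (0 : ℝ) ≤ torusN (u • sParam a + (u * ε) • δ) := by exact_mod_cast torusN_nonneg _
    have h2 : (torusN (u • sParam a + (u * ε) • δ) : ℝ) ≤ 7 := by exact_mod_cast torusN_le_seven _
    have h3 : (0 : ℝ) ≤ torusN (u • sParam a) := by exact_mod_cast torusN_nonneg _
    have h4 : (torusN (u • sParam a) : ℝ) ≤ 7 := by exact_mod_cast torusN_le_seven _
    constructor <;> linarith
  have h := norm_integral_le_of_norm_le hg hdom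
  rw [Real.norm_eq_abs, hval] at h
  exact h

/-! ### An admissible scale for Lemma B, and the slope -/

/-- `K = W·x_max + Y > 0`. -/
theorem clusterBound_pos {a : Dir} (hpos : ∀ k, 0 < h28 a k) (δ : Fin 8 → ℝ) : 0 < clusterBound a δ := by
  unfold clusterBound
  have := mul_pos (clusterWidth_pos hpos δ) (xMax_pos hpos)
  linarith [shiftSize_nonneg δ]

/-- `Y ≤ K`. -/
theorem shiftSize_le_clusterBound {a : Dir} (hpos : ∀ k, 0 < h28 a k) (δ : Fin 8 → ℝ) :
    shiftSize δ ≤ clusterBound a δ := by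
  unfold clusterBound
  have := mul_pos (clusterWidth_pos hpos δ) (xMax_pos hpos)
  linarith

/-- **An admissible scale exists**: some `ρ > 0` satisfies the three hypotheses of Lemma B
(`translateIntegral_shift_linear`): `ρK < 1`, `ρK < d`, and `2ρW ≤` every breakpoint gap of `[0, T]`. -/
theorem exists_admissible_scale {a : Dir} (hpos : ∀ k, 0 < h28 a k) {T : ℝ} (hT : 0 < T) (δ : Fin 8 → ℝ) :
    ∃ ρ : ℝ, 0 < ρ ∧ ρ * clusterBound a δ < 1 ∧ ρ * clusterBound a δ < wallDist a T ∧
      ∀ m, m + 1 < (bkpts a T).card → 2 * ρ * clusterWidth a δ ≤ bkpt a T (m + 1) - bkpt a T m := by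
  have hK := clusterBound_pos hpos δ
  have hW := clusterWidth_pos hpos δ
  have hd := wallDist_pos a T
  have hc := two_le_card_bkpts a hT
  have hne : (Finset.range ((bkpts a T).card - 1)).Nonempty := ⟨0, Finset.mem_range.mpr (by omega)⟩
  -- the smallest breakpoint gap
  obtain ⟨g, hgpos, hgle⟩ : ∃ g : ℝ, 0 < g ∧ ∀ m, m + 1 < (bkpts a T).card → g ≤ bkpt a T (m + 1) - bkpt a T m := by
    refine ⟨(Finset.range ((bkpts a T).card - 1)).inf' hne fun m => bkpt a T (m + 1) - bkpt a T m, ?_,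
      fun m hm => Finset.inf'_le _ (Finset.mem_range.mpr (by omega))⟩
    rw [Finset.lt_inf'_iff]
    intro m hm
    rw [Finset.mem_range] at hm
    exact sub_pos.mpr (bkpt_strictMono (Nat.lt_succ_self m) (by omega))
  have hρpos : 0 < min (min (1 / (2 * clusterBound a δ)) (wallDist a T / (2 * clusterBound a δ)))
      (g / (2 * clusterWidth a δ)) :=
    lt_min (lt_min (div_pos one_pos (by linarith)) (div_pos hd (by linarith))) (div_pos hgpos (by linarith))
  refine ⟨min (min (1 / (2 * clusterBound a δ)) (wallDist a T / (2 * clusterBound a δ)))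
    (g / (2 * clusterWidth a δ)), hρpos, ?_, ?_, fun m hm => ?_⟩
  · calc _ ≤ (1 / (2 * clusterBound a δ)) * clusterBound a δ :=
        mul_le_mul_of_nonneg_right ((min_le_left _ _).trans (min_le_left _ _)) hK.le
      _ = 1 / 2 := by field_simp
      _ < 1 := by norm_num
  · calc _ ≤ (wallDist a T / (2 * clusterBound a δ)) * clusterBound a δ :=
        mul_le_mul_of_nonneg_right ((min_le_left _ _).trans (min_le_right _ _)) hK.le
      _ = wallDist a T / 2 := by field_simp
      _ < wallDist a T := by linarith
  · calc _ ≤ 2 * (g / (2 * clusterWidth a δ)) * clusterWidth a δ := by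
          have := min_le_right (min (1 / (2 * clusterBound a δ)) (wallDist a T / (2 * clusterBound a δ)))
            (g / (2 * clusterWidth a δ))
          nlinarith
      _ = g := by field_simp
      _ ≤ _ := hgle m hm

/-- **The slope does not depend on the admissible scale**: if `ρ` and `ρ'` are both admissible then
`(P(ρ'δ) − P(0)) = ρ'·((P(ρδ) − P(0))/ρ)`. -/
theorem translateIntegral_sub_eq_mul_slope {a : Dir} (hpos : ∀ k, 0 < h28 a k) {T : ℝ} (hT : 0 < T)
    (hper : ∀ k : Fin 28, ∃ z : ℤ, T * h28 a k = z) (δ : Fin 8 → ℝ) {ρ ρ' : ℝ} (hρ : 0 < ρ)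
    (h1 : ρ * clusterBound a δ < 1) (h2 : ρ * clusterBound a δ < wallDist a T)
    (hgap : ∀ m, m + 1 < (bkpts a T).card → 2 * ρ * clusterWidth a δ ≤ bkpt a T (m + 1) - bkpt a T m)
    (hρ' : 0 < ρ') (h1' : ρ' * clusterBound a δ < 1) (h2' : ρ' * clusterBound a δ < wallDist a T)
    (hgap' : ∀ m, m + 1 < (bkpts a T).card → 2 * ρ' * clusterWidth a δ ≤ bkpt a T (m + 1) - bkpt a T m) :
    translateIntegral a T (ρ' • δ) - translateIntegral a T 0
      = ρ' * ((translateIntegral a T (ρ • δ) - translateIntegral a T 0) / ρ) := by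
  -- compare both with the common smaller scale `min ρ ρ'`
  have hm : 0 < min ρ ρ' := lt_min hρ hρ'
  have e1 := translateIntegral_shift_linear hpos hT hper δ hm (min_le_left ρ ρ') h1 h2 hgap
  have e2 := translateIntegral_shift_linear hpos hT hper δ hm (min_le_right ρ ρ') h1' h2' hgap'
  rw [e1] at e2
  -- e2 : (m/ρ)·X = (m/ρ')·X'
  have hX' : translateIntegral a T (ρ' • δ) - translateIntegral a T 0
      = (ρ' / ρ) * (translateIntegral a T (ρ • δ) - translateIntegral a T 0) := by
    have := congrArg (fun x => x * (ρ' / min ρ ρ')) e2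
    field_simp at this
    field_simp
    linarith
  rw [hX']
  field_simp

end Summit.KontsevichZagierPeriods.Zeta5Search.Barrier.ConeGamma

end
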